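import Summits.QuantumFields.YangMills.Theorems.FluctuationComparisonRegPrIntLS2BetaCurlBudgetProfiled
import Summits.QuantumFields.YangMills.Theorems.FluctuationComparisonRegPrIntLS2BetaCovariantOscillationRegUpProfiled
import HarnessLib

/-!
# S2β · (SCT″-c)₁ — «THE c₁ LETTER OVER PHYSICAL LETTERS»: ✓p840789 `c1Budget_profiled`'s oscillation side — the binders `(Olev) (hO0) (hOSC)` (C₇b's covariant
# oscillation letter with a level constant) AND the profile `(o) (ho) (hOlev : Olev(i+1) ≤ o·q_i)` — ALL DISCHARGED by px12 g27's PROFILED knot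
# `hOSC_regUp_profiled` (✓p840777 `hOSC_regUp_closed` ∘ ✓p840907 `oscLetter_le_profile`: «the level-k oscillation letter is one scale power») at every level
# `k := i < K − J` (`N := 2`, `Xd := X`, `q := (L^{2(K−J)})⁻¹`), with its loop∕plaquette classes `α l := if l < K−J then ((d+2)L)²∕4·θ_l else 0`, `δ l := 2θ_l`
# and their one-power profiles (`Cα := ((d+2)L)²∕4·(C_B+1)α`, `Cδ := 2(C_B+1)α`, `hθ1`, all-`l` guards) READ OFF the station's (BKG) binder, and `Olev (i+1) := o·q_i`
# for the EXPLICIT level-free `o(mT, Cε, Cr, Cc; C_B α, d, L, a₀)` of ✓PROFILED (so `hOlev` is `le_rfl` and `ho` is elementary).  The c₁ letter `c1Budget_physical`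
# now displays, on the oscillation∕R-row side, ONLY the knot's PHYSICAL letters {`ε` (line recursion from `ε 0 = 0`), `r` (one-step second-order remainders of the
# relative chart tower), `c₀ k` (the `L^k`-word oscillation of `X 0`, every direction), the window family `hwin`} and their PROFILE constants {`Cε`, `Cr`, `Cc`, `mT`}
# (`hεp`, `hrp`, `hMT : Λ̄·L^k·‖X 0‖ ≤ mT`, `hcc`), next to the size side `hMb`∕`hMbsq`∕`hMbm` (✓p840608 C-M's currency), `hζc`, (T), (BKG), radii windows.

Cell `ym3-torus` (YM ladder rung R3 = continuum `SU(2)` Yang–Mills on the three-torus at fixed lattice data — a RUNG: NOT d = 4, NOT infinite volume, NOT a mass gap,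
NOT Clay).  Width seat `ym-ust-20520-w4` (gen 29); crux `stmt-QuantumFields-20520`, LINE g18-1 S2β; piece (g2) (INTENT 2026-09-01T04:14:25Z; px12 g27 GO 04:15:46Z,
«(g2)'s dock step = PROFILED»).  `--kind proof --supports stmt-QuantumFields-20520 --as helper`, count-neutral, DEFINITION-FREE (0 `def`, 0 `instance`, 0 `notation`,
0 `sorry`, default heartbeats).

WHAT IS PROVED (sorry-free; composition BY NAME).  ★★`oscProfiled_letters` — from (BKG) + smallnesses + the knot's physical letters + the four profile letters: the PAIR
`(∀ i < K−J, 0 ≤ o·q_i) ∧ ⟨✓p840622∕✓p840789's hOSC binder text at Olev := (| kk+1 => o·(L^{2kk}∕L^{2(K−J)}))⟩` (second conjunct = `hOSC_regUp_profiled` at `k := i` BY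
`exact` after ONE rewrite `L^{2i}·(L^{2(K−J)})⁻¹ = L^{2i}∕L^{2(K−J)}`; first = the letter bounds a norm); ★★★`c1Budget_physical` = ✓p840789 `c1Budget_profiled` with
`(Olev hO0 hOSC) (o ho hOlev)` REPLACED by `(ε r c₀ : ℕ → ℝ) (hε0 hεnn hε) (hwin) (hc₀nn hc₀) (hr0 hr) (Cε Cr Cc mT : ℝ) (hCε hCr hCc hmT) (hεp hrp hMT hcc)` and `o`
substituted by PROFILED's explicit constant in the conclusion's R-share — `obtain ⟨hO0, hOSC⟩ := oscProfiled_letters …; exact c1Budget_profiled … (fun _ _ => le_rfl) …`.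

DOMAIN LINE (plan (3) v4; architect px17 g23 04:23:11Z «c₁ column by name: … remaining displayed after (g2): {c₀∕M₀ = B₁s·η = (REG)@rep's Thm 2 (1.36) letters, C-M,
hζc, (T), windows}»).  [Balaban1985Averaging] (19)–(20) p.21, Prop. 3 (121)–(125) p.36, Prop. 4 (128)–(135) pp.37–38; [Balaban1985RegularSpaces] Thm 2 (1.36) p.82;
[Balaban1987RG1] (0.11), (0.18) pp.253–255.

HONEST SCOPE.  Composition of landed letters plus elementary guards∕signs; nothing of Bałaban's renormalisation-group analysis is asserted or proved; every displayed
letter∕profile is a HYPOTHESIS or others'; GAP♯∘ (`stub_uniformFibreGapOrbit`, registry 3732b7df UNTOUCHED, 0∕5), S2β, the five registered stubs, crux 20520, 19936,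
19200 and `YM3TorusSU2` are NOT proved; no registered stub is closed; rung R3 — NOT d = 4, NOT infinite volume, NOT a mass gap, NOT Clay; the Yang–Mills mass gap is
NOT proved.
-/

set_option autoImplicit false

noncomputable section

open scoped Matrix.Norms.L2Operator
open Finset

namespace Summit.QuantumFields.YangMills.Theorems.FluctuationComparisonRegPrIntLS2BetaCurlBudgetPhysical

open Literature.MathematicalPhysics.QuantumFieldTheory.Balaban1983to89
open Literature.MathematicalPhysics.QuantumFieldTheory.Balaban1983to89.T4Continuum
open Literature.MathematicalPhysics.QuantumFieldTheory.Balaban1983to89.T3ContinuumYM3Torus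
open Literature.MathematicalPhysics.QuantumFieldTheory.Balaban1983to89.T3LevelShift
open Literature.MathematicalPhysics.QuantumFieldTheory.Balaban1983to89.T3TiltDescent
open Literature.MathematicalPhysics.QuantumFieldTheory.Balaban1983to89.T3UnitLawDensityEML (ℰp)
open Literature.MathematicalPhysics.QuantumFieldTheory.Balaban1983to89.T4HaarSU2ExpChart (expPoint)
open Literature.MathematicalPhysics.QuantumFieldTheory.Balaban1983to89.T4ExpWindowSmallField (logVec)
open Literature.MathematicalPhysics.QuantumFieldTheory.Balaban1983to89.HaarExponentialChart
open Literature.MathematicalPhysics.QuantumFieldTheory.Balaban1983to89.HaarExponentialChart.IsChartRep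
open Literature.MathematicalPhysics.QuantumFieldTheory.Balaban1983to89.BlockAveraging (Idx blockAvg avgFun loopHol)
open Literature.MathematicalPhysics.QuantumFieldTheory.Balaban1983to89.ExpMeanLog (expMeanLogSU deltaSU)
open Literature.MathematicalPhysics.QuantumFieldTheory.Balaban1983to89.BlockAveragingEMLLinearisedBackground (covWalkSum)
open Literature.MathematicalPhysics.QuantumFieldTheory.Balaban1983to89.B10Eq47AxialChi (shiftN)
open Literature.MathematicalPhysics.QuantumFieldTheory.Balaban1983to89.B14.Eq22Determines (blockIter)
open Literature.MathematicalPhysics.QuantumFieldTheory.Balaban1983to89.B10Eq27TorusAxialLog (rel)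
open Literature.MathematicalPhysics.QuantumFieldTheory.Balaban1983to89.B10Eq18SigmaSU2 (su2Coord)
open Literature.MathematicalPhysics.QuantumFieldTheory.Balaban1983to89.B10Eq18SigmaSU2Haar (rev)
open Literature.MathematicalPhysics.QuantumLattice (su2Quat)
open Summit.QuantumFields.YangMills.Theorems.FluctuationComparisonRegPrIntLS2BetaChartReadDescentOntoExpPoint (su2Coord_rev_mem_lie)
open Summit.QuantumFields.YangMills.Theorems.FluctuationComparisonRegPrIntLS2BetaCurlBudgetProfiled (c1Budget_profiled)
open Summit.QuantumFields.YangMills.Theorems.FluctuationComparisonRegPrIntLS2BetaCovariantOscillationRegUpProfiled (hOSC_regUp_profiled)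
open Literature.MathematicalPhysics.QuantumFieldTheory.Balaban1983to89.B10Eq47AxialChi (rowProd)
open Summit.QuantumFields.YangMills.Theorems.FluctuationComparisonRegPrIntLS2BetaChartReadGaugeCovariance (conj_mem_lie)
open Summit.QuantumFields.YangMills.Theorems.FluctuationComparisonRegPrIntLS2BetaSourceClassesOfBkg (plaqSmall_iter_of_bkg dist1_loopHol_iter_le_of_bkg bkgClass_nonneg bkgClass_lt_two_mul bkgClass_le_base)
open Literature.MathematicalPhysics.QuantumFieldTheory.Balaban1983to89.ExpMeanLog (deltaSU_pos)

variable (F : T3Family)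

/-- ★★ **THE PROFILED OSCILLATION LETTER, CLASSES FROM (BKG)** — px12 g27's `hOSC_regUp_profiled` at every level `i < K − J` (`N := 2`, `Xd := X`,
`q := (L^{2(K−J)})⁻¹`), loop∕plaquette classes, their one-power profiles and all-`l` guards fed from (BKG); returns ✓p840789's `hO0` ∧ `hOSC` binder texts at
`Olev (i+1) := o·(L^{2i}∕L^{2(K−J)})`. [cite: Balaban1985Averaging, (19)-(20) p.21, Prop. 4 (128)-(135) pp.37-38; Balaban1985RegularSpaces, Thm 2 (1.36) p.82] -/
theorem oscProfiled_letters {J K : ℕ}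
    (U₀ : GaugeField (F.P K) 0 (Matrix.specialUnitaryGroup (Fin 2) ℂ))
    (X : (i : ℕ) → PBond (F.P K) i → (specialUnitaryLogChart (Fin 2)).lie)
    (C_B α : ℝ) (hCB : 0 ≤ C_B) (hα : 0 < α)
    (hBKG : ∀ t, t ≤ K - J → ∀ p : Plaq (F.P K) t,
      dist1 (GaugeField.plaqHol (Averaging.iter (fun k => BlockAveraging.blockAvg (P := F.P K) (j := k) ℰp) t U₀) p) ≤
        C_B * α * (F.L : ℝ) ^ (2 * t) * ((F.L : ℝ)⁻¹) ^ (2 * (K - J)))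
    (h24 : (((((F.P K).d + 2) * (F.P K).L : ℕ) : ℝ) ^ 2 / 4) * ((C_B + 1) * α) ≤ 1 / 24)
    (hSU : (((((F.P K).d + 2) * (F.P K).L : ℕ) : ℝ) ^ 2 / 4) * ((C_B + 1) * α) < deltaSU (Fin 2))
    {ρr : ℝ} (hρ0 : 0 < ρr) (hρr : ρr ≤ innerRadius (specialUnitaryLogChart (Fin 2)))
    {a₀ : ℝ} (ha0 : 0 < a₀) (ha : 100 * (((((F.P K).d + 2) * (F.P K).L : ℕ) : ℝ) * (Real.exp a₀ - 1)) ≤ ρr)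
    (hρα : 4 * ((((((F.P K).d + 2) * (F.P K).L : ℕ) : ℝ) ^ 2 / 4) * (2 * ((C_B + 1) * α))) ≤ ρr)
    (ε r c₀ : ℕ → ℝ)
    (hε0 : ε 0 = 0) (hεnn : ∀ i, 0 ≤ ε i) (hε : ∀ i, i < K - J → ((F.P K).L : ℝ) * ε i + 2 * (fun l : ℕ => if l < K - J then (((((F.P K).d + 2) * (F.P K).L : ℕ) : ℝ) ^ 2 / 4) * ((C_B + 1) * α * (F.L : ℝ) ^ (2 * l) * ((F.L : ℝ)⁻¹) ^ (2 * (K - J))) else 0) i ≤ ε (i + 1))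
    (hwin : ∀ k, k < K - J → ∀ i, i < k → 100 * (((((F.P K).d + 2) * (F.P K).L : ℕ) : ℝ) * (((((F.P K).d - 1 : ℕ) : ℝ) * ((2 * (F.P K).L : ℕ) : ℝ) * (fun l : ℕ => 2 * ((C_B + 1) * α * (F.L : ℝ) ^ (2 * l) * ((F.L : ℝ)⁻¹) ^ (2 * (K - J)))) i) + (((((F.P K).d - 1 : ℕ) : ℝ) * ((2 * (F.P K).L : ℕ) : ℝ) * (fun l : ℕ => 2 * ((C_B + 1) * α * (F.L : ℝ) ^ (2 * l) * ((F.L : ℝ)⁻¹) ^ (2 * (K - J)))) i) + ((((F.P K).L ^ (k - i) : ℕ) : ℝ) * (2 * ε i + (fun l : ℕ => 2 * ((C_B + 1) * α * (F.L : ℝ) ^ (2 * l) * ((F.L : ℝ)⁻¹) ^ (2 * (K - J)))) i))))) ≤ ρr)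
    (hc₀nn : ∀ k, 0 ≤ (F.L : ℝ) ^ k * c₀ k)
    (hc₀ : ∀ k, k < K - J → ∀ (μ : Fin (F.P K).d) (b : PBond (F.P K) 0), ‖(((fun b : PBond (F.P K) 0 => (⟨((rowProd U₀ b.src μ ((F.P K).L ^ k) : Matrix.specialUnitaryGroup (Fin 2) ℂ) : Matrix (Fin 2) (Fin 2) ℂ) * (((X 0) (b.translate (Site.scaleTo k ((0 : Site (F.P K) k).shift μ))) : (specialUnitaryLogChart (Fin 2)).lie) : Matrix (Fin 2) (Fin 2) ℂ) * star ((rowProd U₀ b.src μ ((F.P K).L ^ k) : Matrix.specialUnitaryGroup (Fin 2) ℂ) : Matrix (Fin 2) (Fin 2) ℂ), conj_mem_lie (rowProd U₀ b.src μ ((F.P K).L ^ k)) ((X 0) (b.translate (Site.scaleTo k ((0 : Site (F.P K) k).shift μ))))⟩ : (specialUnitaryLogChart (Fin 2)).lie)) b : (specialUnitaryLogChart (Fin 2)).lie) : Matrix (Fin 2) (Fin 2) ℂ) - (((X 0) b : (specialUnitaryLogChart (Fin 2)).lie) : Matrix (Fin 2) (Fin 2) ℂ)‖ ≤ (F.L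 : ℝ) ^ k * c₀ k)
    (hr0 : ∀ l, 0 ≤ r l)
    (hr : ∀ i, i < K - J → ∀ c' : PBond (F.P K) (i + 1),
      ‖((X (i + 1) c' : (specialUnitaryLogChart (Fin 2)).lie) : Matrix (Fin 2) (Fin 2) ℂ) - (((fderiv ℝ (fun (B : PBond (F.P K) i → (specialUnitaryLogChart (Fin 2)).lie) (c' : PBond (F.P K) (i + 1)) => (isChartRep_specialUnitaryGroup (n := Fin 2)).logChart (avgFun (expMeanLogSU (n := Fin 2)) (fun c => (isChartRep_specialUnitaryGroup (n := Fin 2)).expChart (B c) * (Averaging.iter (fun i => blockAvg (P := F.P K) (j := i) (expMeanLogSU (n := Fin 2))) i U₀) c) c' * (avgFun (expMeanLogSU (n := Fin 2)) ((Averaging.iter (fun i => blockAvg (P := F.P K) (j := i) (expMeanLogSU (n := Fin 2))) i U₀)) c')⁻¹)) 0) (X i) c' : (specialUnitaryLogChart (Fin 2)).lie) : Matrix (Fin 2) (Fin 2) ℂ)‖ ≤ r (i + 1))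
    (Cε Cr Cc mT : ℝ) (hCε : 0 ≤ Cε) (hCr : 0 ≤ Cr)
    (hεp : ∀ i, i < K - J → ε i ≤ Cε * ((F.P K).L : ℝ) ^ (2 * i) * ((F.L : ℝ) ^ (2 * (K - J)))⁻¹)
    (hrp : ∀ i, i < K - J → r (i + 1) ≤ Cr * ((F.P K).L : ℝ) ^ (2 * i) * ((F.L : ℝ) ^ (2 * (K - J)))⁻¹)
    (hMT : ∀ k, k < K - J → ((1 + 4 * (((F.P K).d + 2 : ℕ) : ℝ)) * Real.exp ((((F.P K).d + 2 : ℕ) : ℝ) * (422 + 1616 * (((F.P K).d + 2 : ℕ) : ℝ)) * (((((((F.P K).d + 2) * (F.P K).L : ℕ) : ℝ) ^ 2 / 4) * ((C_B + 1) * α)) / (((F.P K).L : ℝ) ^ 2 - 1)))) * ((F.P K).L : ℝ) ^ k * ‖X 0‖ ≤ mT)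
    (hcc : ∀ k, k < K - J → ((1 + 4 * (((F.P K).d + 2 : ℕ) : ℝ)) * Real.exp ((((F.P K).d + 2 : ℕ) : ℝ) * (422 + 1616 * (((F.P K).d + 2 : ℕ) : ℝ)) * (((((((F.P K).d + 2) * (F.P K).L : ℕ) : ℝ) ^ 2 / 4) * ((C_B + 1) * α)) / (((F.P K).L : ℝ) ^ 2 - 1)))) * ((F.P K).L : ℝ) ^ k * ((F.L : ℝ) ^ k * c₀ k) ≤ Cc * (((F.P K).L : ℝ) ^ (2 * k) * ((F.L : ℝ) ^ (2 * (K - J)))⁻¹))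
 :
    (∀ i, i < K - J → 0 ≤ (fun n : ℕ => match n with
            | 0 => (0 : ℝ)
            | kk + 1 => (2 * ((((F.P K).d : ℕ) : ℝ) * ((3 * (F.P K).L : ℕ) : ℝ)) * (2 * Cε * mT + mT * (((1 + 4 * (((F.P K).d + 2 : ℕ) : ℝ)) * Real.exp ((((F.P K).d + 2 : ℕ) : ℝ) * (422 + 1616 * (((F.P K).d + 2 : ℕ) : ℝ)) * (((((((F.P K).d + 2) * (F.P K).L : ℕ) : ℝ) ^ 2 / 4) * ((C_B + 1) * α)) / (((F.P K).L : ℝ) ^ 2 - 1)))) / ((F.P K).L : ℝ)) * ((2 * 67 * ((((F.P K).d + 2) * (F.P K).L : ℕ) : ℝ) / a₀) * (2 * ((((F.P K).d - 1 : ℕ) : ℝ) * ((2 * (F.P K).L : ℕ) : ℝ)) * (2 * ((C_B + 1) * α)) / (((F.P K).L : ℝ) ^ 2 - 1) + (2 * Cε + (2 * ((C_B + 1) * α))) / (((F.P K).L : ℝ) - 1))) + Cc + 2 * (((1 + 4 * (((F.P K).d + 2 : ℕ) : ℝ)) * Real.exp ((((F.P K).d + 2 : ℕ) : ℝ) * (422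 + 1616 * (((F.P K).d + 2 : ℕ) : ℝ)) * (((((((F.P K).d + 2) * (F.P K).L : ℕ) : ℝ) ^ 2 / 4) * ((C_B + 1) * α)) / (((F.P K).L : ℝ) ^ 2 - 1)))) * Cr / (((F.P K).L : ℝ) ^ 2 - ((F.P K).L : ℝ))))) * ((F.L : ℝ) ^ (2 * kk) / (F.L : ℝ) ^ (2 * (K - J)))) (i + 1)) ∧
    (∀ μ ν : Fin (F.P K).d, μ < ν → ∀ i, i < K - J → ∀ (y' : Site (F.P K) (i + 1)) (b b' : PBond (F.P K) i), (blockOf b.src = y' ∨ blockOf b.src = y'.shift μ ∨ blockOf b.src = y'.shift ν ∨ blockOf b.src = (y'.shift μ).shift ν) → (blockOf b'.src = y' ∨ blockOf b'.src = y'.shift μ ∨ blockOf b'.src = y'.shift ν ∨ blockOf b'.src = (y'.shift μ).shift ν) → b.dir = b'.dir →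
      ‖(((T4AxialGaugeSmallField.axialGauge (Averaging.iter (fun k => BlockAveraging.blockAvg (P := F.P K) (j := k) ℰp) i U₀) (fun κ : Fin (F.P K).d => (((emb y' κ).val : ℕ) : ℤ) - ((((F.P K).L - 1) / 2 : ℕ) : ℤ)) (fun κ : Fin (F.P K).d => (((emb y' κ).val : ℕ) : ℤ) + (((if κ = μ then ((F.P K).L : ℤ) else 0) + (if κ = ν then ((F.P K).L : ℤ) else 0)) + ((((F.P K).L - 1) / 2 : ℕ) : ℤ)) + 1)) b.src : Matrix.specialUnitaryGroup (Fin 2) ℂ) : Matrix (Fin 2) (Fin 2) ℂ) * ((X i b : (specialUnitaryLogChart (Fin 2)).lie) : Matrix (Fin 2) (Fin 2) ℂ) * star (((T4AxialGaugeSmallField.axialGauge (Averaging.iter (fun k => BlockAveraging.blockAvg (P := F.P K) (j := k) ℰp) i U₀) (fun κ : Fin (F.P K).d => (((emb y' κ).val : ℕ) : ℤ) - ((((F.P K).L - 1) / 2 : ℕ) : ℤ)) (fun κ : Fin (F.P K).d => (((emb y' κ).val : ℕ) : ℤ) + (((if κ = μ then ((F.P K).L : ℤ) else 0) + (if κ =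 ν then ((F.P K).L : ℤ) else 0)) + ((((F.P K).L - 1) / 2 : ℕ) : ℤ)) + 1)) b.src : Matrix.specialUnitaryGroup (Fin 2) ℂ) : Matrix (Fin 2) (Fin 2) ℂ) -
        ((((T4AxialGaugeSmallField.axialGauge (Averaging.iter (fun k => BlockAveraging.blockAvg (P := F.P K) (j := k) ℰp) i U₀) (fun κ : Fin (F.P K).d => (((emb y' κ).val : ℕ) : ℤ) - ((((F.P K).L - 1) / 2 : ℕ) : ℤ)) (fun κ : Fin (F.P K).d => (((emb y' κ).val : ℕ) : ℤ) + (((if κ = μ then ((F.P K).L : ℤ) else 0) + (if κ = ν then ((F.P K).L : ℤ) else 0)) + ((((F.P K).L - 1) / 2 : ℕ) : ℤ)) + 1)) b'.src : Matrix.specialUnitaryGroup (Fin 2) ℂ) : Matrix (Fin 2) (Fin 2) ℂ) * ((X i b' : (specialUnitaryLogChart (Fin 2)).lie) : Matrix (Fin 2) (Fin 2) ℂ) * star (((T4AxialGaugeSmallField.axialGauge (Averaging.iter (fun k => BlockAveraging.blockAvg (P := F.P K) (j := k) ℰp) i U₀) (fun κ : Fin (F.P K).d => (((emb y' κ).val :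 ℕ) : ℤ) - ((((F.P K).L - 1) / 2 : ℕ) : ℤ)) (fun κ : Fin (F.P K).d => (((emb y' κ).val : ℕ) : ℤ) + (((if κ = μ then ((F.P K).L : ℤ) else 0) + (if κ = ν then ((F.P K).L : ℤ) else 0)) + ((((F.P K).L - 1) / 2 : ℕ) : ℤ)) + 1)) b'.src : Matrix.specialUnitaryGroup (Fin 2) ℂ) : Matrix (Fin 2) (Fin 2) ℂ))‖ ≤
        (fun n : ℕ => match n with
              | 0 => (0 : ℝ)
              | kk + 1 => (2 * ((((F.P K).d : ℕ) : ℝ) * ((3 * (F.P K).L : ℕ) : ℝ)) * (2 * Cε * mT + mT * (((1 + 4 * (((F.P K).d + 2 : ℕ) : ℝ)) * Real.exp ((((F.P K).d + 2 : ℕ) : ℝ) * (422 + 1616 * (((F.P K).d + 2 : ℕ) : ℝ)) * (((((((F.P K).d + 2) * (F.P K).L : ℕ) : ℝ) ^ 2 / 4) * ((C_B + 1) * α)) / (((F.P K).L : ℝ) ^ 2 - 1)))) / ((F.P K).L : ℝ)) * ((2 * 67 * ((((F.P K).d + 2) * (F.P K).L : ℕ) : ℝ) / a₀) * (2 * ((((F.P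 K).d - 1 : ℕ) : ℝ) * ((2 * (F.P K).L : ℕ) : ℝ)) * (2 * ((C_B + 1) * α)) / (((F.P K).L : ℝ) ^ 2 - 1) + (2 * Cε + (2 * ((C_B + 1) * α))) / (((F.P K).L : ℝ) - 1))) + Cc + 2 * (((1 + 4 * (((F.P K).d + 2 : ℕ) : ℝ)) * Real.exp ((((F.P K).d + 2 : ℕ) : ℝ) * (422 + 1616 * (((F.P K).d + 2 : ℕ) : ℝ)) * (((((((F.P K).d + 2) * (F.P K).L : ℕ) : ℝ) ^ 2 / 4) * ((C_B + 1) * α)) / (((F.P K).L : ℝ) ^ 2 - 1)))) * Cr / (((F.P K).L : ℝ) ^ 2 - ((F.P K).L : ℝ))))) * ((F.L : ℝ) ^ (2 * kk) / (F.L : ℝ) ^ (2 * (K - J)))) (i + 1)):= by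
  have hL2 : (2 : ℝ) ≤ (F.L : ℝ) := by exact_mod_cast F.hL.2
  have hL1 : (1 : ℝ) ≤ (F.L : ℝ) := by linarith
  have hL0 : (0 : ℝ) ≤ (F.L : ℝ) := by linarith
  have hCB1 : (0 : ℝ) ≤ C_B + 1 := by linarith
  have hpos : 0 < (C_B + 1) * α := by positivity
  have hKA0 : (0 : ℝ) ≤ (((((F.P K).d + 2) * (F.P K).L : ℕ) : ℝ) ^ 2 / 4) := by positivity
  have hδSU : 0 < deltaSU (Fin 2) := deltaSU_pos
  have hBKG' : ∀ t, t ≤ K - J → ∀ p : Plaq (F.P K) t,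
      dist1 (GaugeField.plaqHol (Averaging.iter (fun k => BlockAveraging.blockAvg (P := F.P K) (j := k) ℰp) t U₀) p) ≤
        (C_B + 1) * α * (F.L : ℝ) ^ (2 * t) * ((F.L : ℝ)⁻¹) ^ (2 * (K - J)) := by
    intro t ht p
    refine (hBKG t ht p).trans ?_
    have h0 : 0 ≤ α * (F.L : ℝ) ^ (2 * t) * ((F.L : ℝ)⁻¹) ^ (2 * (K - J)) :=
      mul_nonneg (mul_nonneg hα.le (pow_nonneg hL0 _)) (pow_nonneg (inv_nonneg.2 hL0) _)
    have h1 : C_B * α * (F.L : ℝ) ^ (2 * t) * ((F.L : ℝ)⁻¹) ^ (2 * (K - J)) =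
        C_B * (α * (F.L : ℝ) ^ (2 * t) * ((F.L : ℝ)⁻¹) ^ (2 * (K - J))) := by ring
    have h2 : (C_B + 1) * α * (F.L : ℝ) ^ (2 * t) * ((F.L : ℝ)⁻¹) ^ (2 * (K - J)) =
        (C_B + 1) * (α * (F.L : ℝ) ^ (2 * t) * ((F.L : ℝ)⁻¹) ^ (2 * (K - J))) := by ring
    rw [h1, h2]
    exact mul_le_mul_of_nonneg_right (by linarith) h0
  have hθ0 : ∀ l : ℕ, 0 ≤ ((C_B + 1) * α * (F.L : ℝ) ^ (2 * l) * ((F.L : ℝ)⁻¹) ^ (2 * (K - J))) := fun l => bkgClass_nonneg F (C_B + 1) α hCB1 hα.le l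
  have hθle : ∀ l, l < K - J → ((C_B + 1) * α * (F.L : ℝ) ^ (2 * l) * ((F.L : ℝ)⁻¹) ^ (2 * (K - J))) ≤ (C_B + 1) * α := fun l hl => bkgClass_le_base F (C_B + 1) α hCB1 hα.le hL1 hl.le
  -- the knot's loop class `α l := if l < K−J then kα·θ_l else 0` and its all-`l` guards
  have hα0' : ∀ l, 0 ≤ (fun l : ℕ => if l < K - J then (((((F.P K).d + 2) * (F.P K).L : ℕ) : ℝ) ^ 2 / 4) * ((C_B + 1) * α * (F.L : ℝ) ^ (2 * l) * ((F.L : ℝ)⁻¹) ^ (2 * (K - J))) else 0) l := by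
    intro l; dsimp only; split_ifs
    · exact mul_nonneg hKA0 (hθ0 l)
    · exact le_rfl
  have hα24' : ∀ l, (fun l : ℕ => if l < K - J then (((((F.P K).d + 2) * (F.P K).L : ℕ) : ℝ) ^ 2 / 4) * ((C_B + 1) * α * (F.L : ℝ) ^ (2 * l) * ((F.L : ℝ)⁻¹) ^ (2 * (K - J))) else 0) l ≤ 1 / 24 := by
    intro l; dsimp only; split_ifs with hl
    · have h := mul_le_mul_of_nonneg_left (hθle l hl) hKA0
      linarith
    · norm_num
  have hαδ' : ∀ l, (fun l : ℕ => if l < K - J then (((((F.P K).d + 2) * (F.P K).L : ℕ) : ℝ) ^ 2 / 4) * ((C_B + 1) * α * (F.L : ℝ) ^ (2 * l) * ((F.L : ℝ)⁻¹) ^ (2 * (K - J))) else 0) l < deltaSU (Fin 2) := by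
    intro l; dsimp only; split_ifs with hl
    · have h := mul_le_mul_of_nonneg_left (hθle l hl) hKA0
      linarith
    · exact hδSU
  have hα4' : ∀ l, 4 * (fun l : ℕ => if l < K - J then (((((F.P K).d + 2) * (F.P K).L : ℕ) : ℝ) ^ 2 / 4) * ((C_B + 1) * α * (F.L : ℝ) ^ (2 * l) * ((F.L : ℝ)⁻¹) ^ (2 * (K - J))) else 0) l ≤ ρr := by
    intro l; dsimp only; split_ifs with hl
    · have h := mul_le_mul_of_nonneg_left (hθle l hl) hKA0
      nlinarith [hρα, hθ0 l]
    · linarith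
  have hαU' : ∀ l, l < K - J → ∀ (c : PBond (F.P K) (l + 1)) (idx : Idx (F.P K)),
      dist1 (loopHol (Averaging.iter (fun k => BlockAveraging.blockAvg (P := F.P K) (j := k) ℰp) l U₀) c idx) ≤ (fun l : ℕ => if l < K - J then (((((F.P K).d + 2) * (F.P K).L : ℕ) : ℝ) ^ 2 / 4) * ((C_B + 1) * α * (F.L : ℝ) ^ (2 * l) * ((F.L : ℝ)⁻¹) ^ (2 * (K - J))) else 0) l := by
    intro l hl c idx
    dsimp only; rw [if_pos hl]
    exact dist1_loopHol_iter_le_of_bkg F U₀ (C_B + 1) α hCB1 hα.le hBKG' l hl c idx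
  -- the knot's plaquette class `δ l := 2θ_l`
  have hδ0' : ∀ l, 0 ≤ (fun l : ℕ => 2 * ((C_B + 1) * α * (F.L : ℝ) ^ (2 * l) * ((F.L : ℝ)⁻¹) ^ (2 * (K - J)))) l := fun l => mul_nonneg zero_le_two (hθ0 l)
  have hδ' : ∀ l, l < K - J → PlaqSmall ((fun l : ℕ => 2 * ((C_B + 1) * α * (F.L : ℝ) ^ (2 * l) * ((F.L : ℝ)⁻¹) ^ (2 * (K - J)))) l)
      (Averaging.iter (fun k => BlockAveraging.blockAvg (P := F.P K) (j := k) ℰp) l U₀) :=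
    plaqSmall_iter_of_bkg F U₀ (C_B + 1) α hBKG' (fun l : ℕ => 2 * ((C_B + 1) * α * (F.L : ℝ) ^ (2 * l) * ((F.L : ℝ)⁻¹) ^ (2 * (K - J)))) (fun n _ => bkgClass_lt_two_mul F (C_B + 1) α hpos (by linarith) n)
  -- profile side-facts
  have hq : (0 : ℝ) ≤ ((F.L : ℝ) ^ (2 * (K - J)))⁻¹ := by positivity
  have hCα : (0 : ℝ) ≤ ((((((F.P K).d + 2) * (F.P K).L : ℕ) : ℝ) ^ 2 / 4) * ((C_B + 1) * α)) := by positivity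
  have hCδ : (0 : ℝ) ≤ (2 * ((C_B + 1) * α)) := by positivity
  have hθ1 : ∀ i, i < K - J → ((F.P K).L : ℝ) ^ (2 * i) * ((F.L : ℝ) ^ (2 * (K - J)))⁻¹ ≤ 1 := by
    intro i hi
    show (F.L : ℝ) ^ (2 * i) * ((F.L : ℝ) ^ (2 * (K - J)))⁻¹ ≤ 1
    rw [← div_eq_mul_inv, div_le_one (pow_pos (by linarith) _)]
    exact pow_le_pow_right₀ hL1 (by omega)
  have hαp : ∀ i, i < K - J → ∀ j, j < i → (fun l : ℕ => if l < K - J then (((((F.P K).d + 2) * (F.P K).L : ℕ) : ℝ) ^ 2 / 4) * ((C_B + 1) * α * (F.L : ℝ) ^ (2 * l) * ((F.L : ℝ)⁻¹) ^ (2 * (K - J))) else 0) j ≤ ((((((F.P K).d + 2) * (F.P K).L : ℕ) : ℝ) ^ 2 / 4) * ((C_B + 1) * α)) * ((F.P K).L : ℝ) ^ (2 * j) * ((F.L : ℝ) ^ (2 * (K - J)))⁻¹ := by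
    intro i hi j hj
    dsimp only; rw [if_pos (lt_trans hj hi)]
    show (((((F.P K).d + 2) * (F.P K).L : ℕ) : ℝ) ^ 2 / 4) * ((C_B + 1) * α * (F.L : ℝ) ^ (2 * j) * ((F.L : ℝ)⁻¹) ^ (2 * (K - J))) ≤ ((((((F.P K).d + 2) * (F.P K).L : ℕ) : ℝ) ^ 2 / 4) * ((C_B + 1) * α)) * (F.L : ℝ) ^ (2 * j) * ((F.L : ℝ) ^ (2 * (K - J)))⁻¹
    rw [inv_pow]; exact le_of_eq (by ring)
  have hδp : ∀ j : ℕ, (fun l : ℕ => 2 * ((C_B + 1) * α * (F.L : ℝ) ^ (2 * l) * ((F.L : ℝ)⁻¹) ^ (2 * (K - J)))) j ≤ (2 * ((C_B + 1) * α)) * ((F.P K).L : ℝ) ^ (2 * j) * ((F.L : ℝ) ^ (2 * (K - J)))⁻¹ := by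
    intro j
    show 2 * ((C_B + 1) * α * (F.L : ℝ) ^ (2 * j) * ((F.L : ℝ)⁻¹) ^ (2 * (K - J))) ≤ (2 * ((C_B + 1) * α)) * (F.L : ℝ) ^ (2 * j) * ((F.L : ℝ) ^ (2 * (K - J)))⁻¹
    rw [inv_pow]; exact le_of_eq (by ring)
  -- a direction and the profiled knot at every level `i < K − J`
  have hd3 : 0 < (F.P K).d := by show 0 < 3; norm_num
  have hknot : ∀ i, i < K - J → ∀ {μ ν : Fin (F.P K).d} (y' : Site (F.P K) (i + 1)) (b b' : PBond (F.P K) i),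
      (blockOf b.src = y' ∨ blockOf b.src = y'.shift μ ∨ blockOf b.src = y'.shift ν ∨ blockOf b.src = (y'.shift μ).shift ν) →
      (blockOf b'.src = y' ∨ blockOf b'.src = y'.shift μ ∨ blockOf b'.src = y'.shift ν ∨ blockOf b'.src = (y'.shift μ).shift ν) →
      b.dir = b'.dir → _ := fun i hi μ ν y' b b' hb hb' hdir =>
    hOSC_regUp_profiled F (K := K) (k := i) (by have := F.hm; omega) U₀ X hα0' hα24' hαδ'
      (fun l hl c idx => hαU' l (lt_trans hl hi) c idx) hρ0 hρr hα4' hδ0' (fun l hl => hδ' l (lt_trans hl hi))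
      hε0 hεnn (fun j hj => hε j (lt_trans hj hi)) (hwin i hi) ha0 ha (hc₀nn i) (hc₀ i hi) hr0 (fun j hj => hr j (lt_trans hj hi))
      hq hCα hCδ hCε hCr (hθ1 i hi) (hαp i hi) (fun j _ => hδp j) (fun j hj => hεp j (by omega)) (fun j hj => hrp j (lt_trans hj hi))
      (hMT i hi) (hcc i hi) y' b b' hb hb' hdir
  have e : ∀ i : ℕ, ((F.P K).L : ℝ) ^ (2 * i) * ((F.L : ℝ) ^ (2 * (K - J)))⁻¹ = (F.L : ℝ) ^ (2 * i) / (F.L : ℝ) ^ (2 * (K - J)) := fun i => by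
    rw [div_eq_mul_inv]; rfl
  refine ⟨?_, ?_⟩
  · -- hO0: the letter bounds a norm
    intro i hi
    have h := hknot i hi (μ := ⟨0, hd3⟩) (ν := ⟨0, hd3⟩) (blockOf (default : Site (F.P K) i))
      ⟨default, ⟨0, hd3⟩⟩ ⟨default, ⟨0, hd3⟩⟩ (Or.inl rfl) (Or.inl rfl) rfl
    rw [e i] at h
    exact (norm_nonneg _).trans h
  · -- hOSC
    intro μ ν _ i hi y' b b' hb hb' hdir
    have h := hknot i hi y' b b' hb hb' hdir
    rw [e i] at h
    exact h

/-- ★★★ **THE c₁ LETTER OVER PHYSICAL LETTERS** — ✓`c1Budget_profiled` ∘ ✓`oscProfiled_letters`; see the module header.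
[cite: Balaban1985Averaging, Prop. 3 (123), Prop. 4 (128)-(135) pp.37-38; Balaban1985RegularSpaces, Thm 2 (1.36) p.82; Balaban1987RG1, (0.11), (0.18) pp.253-255] -/
theorem c1Budget_physical {J K : ℕ} (hJK : J ≤ K) (Cst : ℝ) (hCst : 0 ≤ Cst)
    (U₀ : GaugeField (F.P K) 0 (Matrix.specialUnitaryGroup (Fin 2) ℂ)) (ζ : PBond (F.P K) 0 → EuclideanSpace ℝ (Fin 3))
    (X : (i : ℕ) → PBond (F.P K) i → (specialUnitaryLogChart (Fin 2)).lie)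
    (hXdef : X = fun (i : ℕ) (b : PBond (F.P K) i) =>
      (⟨su2Coord (rev (logVec (su2Quat (Averaging.iter (fun k => BlockAveraging.blockAvg (P := F.P K) (j := k) ℰp) i (fun ℓ => expPoint (ζ ℓ) * U₀ ℓ : GaugeField (F.P K) 0 (Matrix.specialUnitaryGroup (Fin 2) ℂ)) b * (Averaging.iter (fun k => BlockAveraging.blockAvg (P := F.P K) (j := k) ℰp) i U₀ b)⁻¹)))), su2Coord_rev_mem_lie _⟩ : (specialUnitaryLogChart (Fin 2)).lie))
    (Mg : ℕ → ℝ) (hMg : ∀ t, t ≤ K - J → ∀ b : PBond (F.P K) t,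
      ‖logVec (su2Quat (Averaging.iter (fun k => BlockAveraging.blockAvg (P := F.P K) (j := k) ℰp) t (fun ℓ => expPoint (ζ ℓ) * U₀ ℓ : GaugeField (F.P K) 0 (Matrix.specialUnitaryGroup (Fin 2) ℂ)) b * (Averaging.iter (fun k => BlockAveraging.blockAvg (P := F.P K) (j := k) ℰp) t U₀ b)⁻¹))‖ ≤ Mg t)
    (hMg4 : ∀ t, t ≤ K - J → Mg t ≤ 1 / 4)
    (C_B α : ℝ) (hCB : 0 ≤ C_B) (hα : 0 < α)
    (hBKG : ∀ t, t ≤ K - J → ∀ p : Plaq (F.P K) t,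
      dist1 (GaugeField.plaqHol (Averaging.iter (fun k => BlockAveraging.blockAvg (P := F.P K) (j := k) ℰp) t U₀) p) ≤
        C_B * α * (F.L : ℝ) ^ (2 * t) * ((F.L : ℝ)⁻¹) ^ (2 * (K - J)))
    (h24 : ((((F.P K).d + 2) * (F.P K).L : ℕ) : ℝ) ^ 2 / 4 * ((C_B + 1) * α) ≤ 1 / 24)
    (hSU : ((((F.P K).d + 2) * (F.P K).L : ℕ) : ℝ) ^ 2 / 4 * ((C_B + 1) * α) < deltaSU (Fin 2))
    {ρr : ℝ} (hρ0 : 0 < ρr) (hρr : ρr ≤ innerRadius (specialUnitaryLogChart (Fin 2)))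
    {a₀ : ℝ} (ha0 : 0 < a₀) (ha : 100 * (((((F.P K).d + 2) * (F.P K).L : ℕ) : ℝ) * (Real.exp a₀ - 1)) ≤ ρr)
    (Mb : ℕ → ℝ) (hMb0 : ∀ i, i < K - J → 0 ≤ Mb i) (hMb : ∀ i, i < K - J → ∀ b : PBond (F.P K) i, ‖X i b‖ ≤ Mb i) (hMb16 : ∀ i, i < K - J → 16 * Mb i ≤ a₀)
    (ε r c₀ : ℕ → ℝ)
    (hε0 : ε 0 = 0) (hεnn : ∀ i, 0 ≤ ε i) (hε : ∀ i, i < K - J → ((F.P K).L : ℝ) * ε i + 2 * (fun l : ℕ => if l < K - J then (((((F.P K).d + 2) * (F.P K).L : ℕ) : ℝ) ^ 2 / 4) * ((C_B + 1) * α * (F.L : ℝ) ^ (2 * l) * ((F.L : ℝ)⁻¹) ^ (2 * (K - J))) else 0) i ≤ ε (i + 1))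
    (hwin : ∀ k, k < K - J → ∀ i, i < k → 100 * (((((F.P K).d + 2) * (F.P K).L : ℕ) : ℝ) * (((((F.P K).d - 1 : ℕ) : ℝ) * ((2 * (F.P K).L : ℕ) : ℝ) * (fun l : ℕ => 2 * ((C_B + 1) * α * (F.L : ℝ) ^ (2 * l) * ((F.L : ℝ)⁻¹) ^ (2 * (K - J)))) i) + (((((F.P K).d - 1 : ℕ) : ℝ) * ((2 * (F.P K).L : ℕ) : ℝ) * (fun l : ℕ => 2 * ((C_B + 1) * α * (F.L : ℝ) ^ (2 * l) * ((F.L : ℝ)⁻¹) ^ (2 * (K - J)))) i) + ((((F.P K).L ^ (k - i) : ℕ) : ℝ) * (2 * ε i + (fun l : ℕ => 2 * ((C_B + 1) * α * (F.L : ℝ) ^ (2 * l) * ((F.L : ℝ)⁻¹) ^ (2 * (K - J)))) i))))) ≤ ρr)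
    (hc₀nn : ∀ k, 0 ≤ (F.L : ℝ) ^ k * c₀ k)
    (hc₀ : ∀ k, k < K - J → ∀ (μ : Fin (F.P K).d) (b : PBond (F.P K) 0), ‖(((fun b : PBond (F.P K) 0 => (⟨((rowProd U₀ b.src μ ((F.P K).L ^ k) : Matrix.specialUnitaryGroup (Fin 2) ℂ) : Matrix (Fin 2) (Fin 2) ℂ) * (((X 0) (b.translate (Site.scaleTo k ((0 : Site (F.P K) k).shift μ))) : (specialUnitaryLogChart (Fin 2)).lie) : Matrix (Fin 2) (Fin 2) ℂ) * star ((rowProd U₀ b.src μ ((F.P K).L ^ k) : Matrix.specialUnitaryGroup (Fin 2) ℂ) : Matrix (Fin 2) (Fin 2) ℂ), conj_mem_lie (rowProd U₀ b.src μ ((F.P K).L ^ k)) ((X 0) (b.translate (Site.scaleTo k ((0 : Site (F.P K) k).shift μ))))⟩ : (specialUnitaryLogChart (Fin 2)).lie)) b : (specialUnitaryLogChart (Fin 2)).lie) : Matrix (Fin 2) (Fin 2) ℂ) - (((X 0) b : (specialUnitaryLogChart (Fin 2)).lie) : Matrix (Fin 2) (Fin 2) ℂ)‖ ≤ (F.L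 : ℝ) ^ k * c₀ k)
    (hr0 : ∀ l, 0 ≤ r l)
    (hr : ∀ i, i < K - J → ∀ c' : PBond (F.P K) (i + 1),
      ‖((X (i + 1) c' : (specialUnitaryLogChart (Fin 2)).lie) : Matrix (Fin 2) (Fin 2) ℂ) - (((fderiv ℝ (fun (B : PBond (F.P K) i → (specialUnitaryLogChart (Fin 2)).lie) (c' : PBond (F.P K) (i + 1)) => (isChartRep_specialUnitaryGroup (n := Fin 2)).logChart (avgFun (expMeanLogSU (n := Fin 2)) (fun c => (isChartRep_specialUnitaryGroup (n := Fin 2)).expChart (B c) * (Averaging.iter (fun i => blockAvg (P := F.P K) (j := i) (expMeanLogSU (n := Fin 2))) i U₀) c) c' * (avgFun (expMeanLogSU (n := Fin 2)) ((Averaging.iter (fun i => blockAvg (P := F.P K) (j := i) (expMeanLogSU (n := Fin 2))) i U₀)) c')⁻¹)) 0) (X i) c' : (specialUnitaryLogChart (Fin 2)).lie) : Matrix (Fin 2) (Fin 2) ℂ)‖ ≤ r (i + 1))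
    (Cε Cr Cc mT : ℝ) (hCε : 0 ≤ Cε) (hCr : 0 ≤ Cr) (hCc : 0 ≤ Cc) (hmT : 0 ≤ mT)
    (hεp : ∀ i, i < K - J → ε i ≤ Cε * ((F.P K).L : ℝ) ^ (2 * i) * ((F.L : ℝ) ^ (2 * (K - J)))⁻¹)
    (hrp : ∀ i, i < K - J → r (i + 1) ≤ Cr * ((F.P K).L : ℝ) ^ (2 * i) * ((F.L : ℝ) ^ (2 * (K - J)))⁻¹)
    (hMT : ∀ k, k < K - J → ((1 + 4 * (((F.P K).d + 2 : ℕ) : ℝ)) * Real.exp ((((F.P K).d + 2 : ℕ) : ℝ) * (422 + 1616 * (((F.P K).d + 2 : ℕ) : ℝ)) * (((((((F.P K).d + 2) * (F.P K).L : ℕ) : ℝ) ^ 2 / 4) * ((C_B + 1) * α)) / (((F.P K).L : ℝ) ^ 2 - 1)))) * ((F.P K).L : ℝ) ^ k * ‖X 0‖ ≤ mT)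
    (hcc : ∀ k, k < K - J → ((1 + 4 * (((F.P K).d + 2 : ℕ) : ℝ)) * Real.exp ((((F.P K).d + 2 : ℕ) : ℝ) * (422 + 1616 * (((F.P K).d + 2 : ℕ) : ℝ)) * (((((((F.P K).d + 2) * (F.P K).L : ℕ) : ℝ) ^ 2 / 4) * ((C_B + 1) * α)) / (((F.P K).L : ℝ) ^ 2 - 1)))) * ((F.P K).L : ℝ) ^ k * ((F.L : ℝ) ^ k * c₀ k) ≤ Cc * (((F.P K).L : ℝ) ^ (2 * k) * ((F.L : ℝ) ^ (2 * (K - J)))⁻¹))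
    (hρα : 4 * ((((((F.P K).d + 2) * (F.P K).L : ℕ) : ℝ) ^ 2 / 4) * (2 * ((C_B + 1) * α))) ≤ ρr)
    (hρδ : 100 * (((((F.P K).d + 2) * (F.P K).L : ℕ) : ℝ) * ((((F.P K).d - 1 : ℕ) : ℝ) * ((3 * (F.P K).L : ℕ) : ℝ) * (2 * ((C_B + 1) * α)))) ≤ ρr)
    (m : ℝ)
    (hMbsq : ∀ i, i < K - J → Mb i ^ 2 ≤ m ^ 2 * ((F.L : ℝ) ^ (2 * i) / (F.L : ℝ) ^ (2 * (K - J))))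
    (hMbm : ∀ i, i < K - J → Mb i ≤ m)
    (c : ℝ) (hc0 : 0 ≤ c) (hc4 : 4 * c ≤ 1)
    (hζc : ∀ ℓ : PBond (F.P K) 0, ‖ζ ℓ‖ ≤ c * ((F.L : ℝ)⁻¹) ^ (K - J))
    (Mbar : ℝ) (hM0 : 0 ≤ Mbar) (hM1 : 4 * Mbar ≤ 1)
    (hM : ∀ s, s < K - J → ∀ b : PBond (F.P K) s, ‖logVec (su2Quat (Averaging.iter (fun k => BlockAveraging.blockAvg (P := F.P K) (j := k) ℰp) s (fun ℓ => expPoint (ζ ℓ) * U₀ ℓ : GaugeField (F.P K) 0 (Matrix.specialUnitaryGroup (Fin 2) ℂ)) b * (Averaging.iter (fun k => BlockAveraging.blockAvg (P := F.P K) (j := k) ℰp) s U₀ b)⁻¹))‖ ≤ Mbar) :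
    ∑ t ∈ Finset.range (K - J), (F.L : ℝ) ^ t * (fun t => Cst * ∑ B : PBond (F.P J) 0,
      ‖(fun p : Plaq (F.P K) (K - J - 1 - t) =>
        if ∃ z₀ : Site (F.P K) 0, (blockIter (K - J) z₀ = (bondShift (F.sitesPerDir_eq (m := F.m) (K := J) (j := 0) (m' := F.m) (K' := K) (j' := K - J) (by omega)) B).src ∨
            blockIter (K - J) z₀ = (bondShift (F.sitesPerDir_eq (m := F.m) (K := J) (j := 0) (m' := F.m) (K' := K) (j' := K - J) (by omega)) B).tgt) ∧
            ∀ κ, (rel (blockIter (K - J - 1 - t) z₀) p.src κ).natAbs ≤ (2 * F.L + 1)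
        then dist1 ((GaugeField.plaqHol (Averaging.iter (fun k => BlockAveraging.blockAvg (P := F.P K) (j := k) ℰp) (K - J - 1 - t) U₀) p)⁻¹ *
          GaugeField.plaqHol (Averaging.iter (fun k => BlockAveraging.blockAvg (P := F.P K) (j := k) ℰp) (K - J - 1 - t)
            (fun ℓ => expPoint (ζ ℓ) * U₀ ℓ : GaugeField (F.P K) 0 (Matrix.specialUnitaryGroup (Fin 2) ℂ))) p)
        else 0)‖ ^ 2) t ≤
      2 * ((2 * Cst * (((5 ^ (F.P K).d : ℕ) : ℝ) ^ 2 * (((2 * ((2 * F.L + 1) + 2) + 1) ^ (F.P K).d * 6 : ℕ) : ℝ) *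
              (2 * ((((F.P K).L ^ (F.P K).d : ℕ) : ℝ) - 1) / ((((F.P K).L ^ (F.P K).d : ℕ) : ℝ) - 3)))) * (4 * (F.L : ℝ)⁻¹ * ((F.L : ℝ) ^ (K - J) * ∑ p : Plaq (F.P K) 0,
                  (1 - reTr ((GaugeField.plaqHol U₀ p)⁻¹ * GaugeField.plaqHol (fun ℓ => expPoint (ζ ℓ) * U₀ ℓ : GaugeField (F.P K) 0 (Matrix.specialUnitaryGroup (Fin 2) ℂ)) p))) + 7 *
      (12 * ((F.P K).d : ℝ) ^ 2 * (2 * ((F.P K).L : ℝ) ^ 2 * (3 * (F.P K).L + 2) + 2 * ((F.P K).L : ℝ) ^ 2 + (48 * (F.P K).L + 24 * ((((F.P K).d + 2) * (F.P K).L : ℕ) : ℝ) + 1616 * ((((F.P K).d + 2) * (F.P K).L : ℕ) : ℝ)) * (((((F.P K).d + 2) * (F.P K).L : ℕ) : ℝ) ^ 2 / 4) +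
        2 * ((((F.P K).d + 2) * (F.P K).L : ℕ) : ℝ) * ((F.L : ℝ) ^ 2)) ^ 2 * (2 * ((C_B + 1) * α)) ^ 2 *
        (∑ t ∈ Finset.range (K - J), (if ht : t < K - J then
          (F.L : ℝ) ^ t * ∑ B : PBond (F.P J) 0,
            ‖(fun ℓ' : PBond (F.P (J + (t + 1))) 0 =>
              if ∃ z : Site (F.P (J + (t + 1))) 0,
                (B14.Eq22Determines.blockIter (t + 1) z = (bondShift (F.sitesPerDir_eq (m := F.m) (K := J) (j := 0) (m' := F.m) (K' := J + (t + 1)) (j' := t + 1) (by omega)) B).src ∨ B14.Eq22Determines.blockIter (t + 1) z = (bondShift (F.sitesPerDir_eq (m := F.m) (K := J) (j := 0) (m' := F.m) (K' := J + (t + 1)) (j' := t + 1) (by omega)) B).tgt) ∧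
                ∀ ν, (B10Eq27TorusAxialLog.rel z ℓ'.src ν).natAbs ≤ 2
              then logVec (su2Quat (descendTo F ℰp (J + (t + 1)) K (by omega) (fun ℓ => expPoint (ζ ℓ) * U₀ ℓ : GaugeField (F.P K) 0 (Matrix.specialUnitaryGroup (Fin 2) ℂ)) ℓ' * (descendTo F ℰp (J + (t + 1)) K (by omega) U₀ ℓ')⁻¹)) else 0)‖ ^ 2
        else 0)) / (F.L : ℝ) +
      (192 * ((F.P K).d : ℝ) ^ 2 *
        (16 * (54 * (((((F.P K).d + 2) * (F.P K).L : ℕ) : ℝ) * (Real.exp a₀ - 1))) * (2 * ((((F.P K).d : ℕ) : ℝ) * ((3 * (F.P K).L : ℕ) : ℝ)) * (2 * Cε * mT + mT * (((1 + 4 * (((F.P K).d + 2 : ℕ) : ℝ)) * Real.exp ((((F.P K).d + 2 : ℕ) : ℝ) * (422 + 1616 * (((F.P K).d + 2 : ℕ) : ℝ)) * (((((((F.P K).d + 2) * (F.P K).L : ℕ) : ℝ) ^ 2 / 4) * ((C_B + 1) * α)) / (((F.P K).L : ℝ) ^ 2 - 1)))) / ((F.P K).L : ℝ)) * ((2 *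 67 * ((((F.P K).d + 2) * (F.P K).L : ℕ) : ℝ) / a₀) * (2 * ((((F.P K).d - 1 : ℕ) : ℝ) * ((2 * (F.P K).L : ℕ) : ℝ)) * (2 * ((C_B + 1) * α)) / (((F.P K).L : ℝ) ^ 2 - 1) + (2 * Cε + (2 * ((C_B + 1) * α))) / (((F.P K).L : ℝ) - 1))) + Cc + 2 * (((1 + 4 * (((F.P K).d + 2 : ℕ) : ℝ)) * Real.exp ((((F.P K).d + 2 : ℕ) : ℝ) * (422 + 1616 * (((F.P K).d + 2 : ℕ) : ℝ)) * (((((((F.P K).d + 2) * (F.P K).L : ℕ) : ℝ) ^ 2 / 4) * ((C_B + 1) * α)) / (((F.P K).L : ℝ) ^ 2 - 1)))) * Cr / (((F.P K).L : ℝ) ^ 2 - ((F.P K).L : ℝ))))) / (15 * a₀ / 16) ^ 2 + 32 * (54 * (((((F.P K).d + 2) * (F.P K).L : ℕ) : ℝ) * (Real.exp a₀ - 1))) * (2 * ((((F.P K).d : ℕ) : ℝ) * ((3 * (F.P K).L : ℕ) : ℝ)) * (2 * Cε * mT + mT * (((1 + 4 * (((F.P K).d + 2 : ℕ) : ℝ))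 * Real.exp ((((F.P K).d + 2 : ℕ) : ℝ) * (422 + 1616 * (((F.P K).d + 2 : ℕ) : ℝ)) * (((((((F.P K).d + 2) * (F.P K).L : ℕ) : ℝ) ^ 2 / 4) * ((C_B + 1) * α)) / (((F.P K).L : ℝ) ^ 2 - 1)))) / ((F.P K).L : ℝ)) * ((2 * 67 * ((((F.P K).d + 2) * (F.P K).L : ℕ) : ℝ) / a₀) * (2 * ((((F.P K).d - 1 : ℕ) : ℝ) * ((2 * (F.P K).L : ℕ) : ℝ)) * (2 * ((C_B + 1) * α)) / (((F.P K).L : ℝ) ^ 2 - 1) + (2 * Cε + (2 * ((C_B + 1) * α))) / (((F.P K).L : ℝ) - 1))) + Cc + 2 * (((1 + 4 * (((F.P K).d + 2 : ℕ) : ℝ)) * Real.exp ((((F.P K).d + 2 : ℕ) : ℝ) * (422 + 1616 * (((F.P K).d + 2 : ℕ) : ℝ)) * (((((((F.P K).d + 2) * (F.P K).L : ℕ) : ℝ) ^ 2 / 4) * ((C_B + 1) * α)) / (((F.P K).L : ℝ) ^ 2 - 1)))) * Cr / (((F.P K).L : ℝ) ^ 2 - ((F.P K).L : ℝ))))) /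 a₀ ^ 2 +
          ((((F.P K).d + 2) * (F.P K).L : ℕ) : ℝ) ^ 3 * m ^ 2 + 8 * (67 * (((((F.P K).d + 2) * (F.P K).L : ℕ) : ℝ) * ((((F.P K).d - 1 : ℕ) : ℝ) * ((3 * (F.P K).L : ℕ) : ℝ) * (2 * ((C_B + 1) * α))))) * m / a₀ ^ 2) ^ 2 *
        (∑ t ∈ Finset.range (K - J), (if ht : t < K - J then
          (F.L : ℝ) ^ t * ∑ B : PBond (F.P J) 0,
            ‖(fun ℓ' : PBond (F.P (J + (t + 1))) 0 =>
              if ∃ z : Site (F.P (J + (t + 1))) 0,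
                (B14.Eq22Determines.blockIter (t + 1) z = (bondShift (F.sitesPerDir_eq (m := F.m) (K := J) (j := 0) (m' := F.m) (K' := J + (t + 1)) (j' := t + 1) (by omega)) B).src ∨ B14.Eq22Determines.blockIter (t + 1) z = (bondShift (F.sitesPerDir_eq (m := F.m) (K := J) (j := 0) (m' := F.m) (K' := J + (t + 1)) (j' := t + 1) (by omega)) B).tgt) ∧
                ∀ ν, (B10Eq27TorusAxialLog.rel z ℓ'.src ν).natAbs ≤ 2
              then logVec (su2Quat (descendTo F ℰp (J + (t + 1)) K (by omega) (fun ℓ => expPoint (ζ ℓ) * U₀ ℓ : GaugeField (F.P K) 0 (Matrix.specialUnitaryGroup (Fin 2) ℂ)) ℓ' * (descendTo F ℰp (J + (t + 1)) K (by omega) U₀ ℓ')⁻¹)) else 0)‖ ^ 2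
        else 0)) / (F.L : ℝ)) +
      3 * ((768 * c ^ 2 * (F.L : ℝ)) *
        (((F.L : ℝ)⁻¹) ^ (K - J) * ∑ ℓ : PBond (F.P K) 0, ‖ζ ℓ‖ ^ 2 +
          (F.L : ℝ) ^ (K - J) * ∑ p : Plaq (F.P K) 0,
            (1 - reTr ((GaugeField.plaqHol U₀ p)⁻¹ * GaugeField.plaqHol (fun ℓ => expPoint (ζ ℓ) * U₀ ℓ : GaugeField (F.P K) 0 (Matrix.specialUnitaryGroup (Fin 2) ℂ)) p))))))) +
      2 * ((256 * Cst * Mbar ^ 2 * ((2 * (F.P J).d * (2 * 3 + 1) ^ (F.P J).d : ℕ) : ℝ)) * (∑ t ∈ Finset.range (K - J), (if ht : t < K - J then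
          (F.L : ℝ) ^ t * ∑ B : PBond (F.P J) 0,
            ‖(fun ℓ' : PBond (F.P (J + (t + 1))) 0 =>
              if ∃ z : Site (F.P (J + (t + 1))) 0,
                (B14.Eq22Determines.blockIter (t + 1) z = (bondShift (F.sitesPerDir_eq (m := F.m) (K := J) (j := 0) (m' := F.m) (K' := J + (t + 1)) (j' := t + 1) (by omega)) B).src ∨ B14.Eq22Determines.blockIter (t + 1) z = (bondShift (F.sitesPerDir_eq (m := F.m) (K := J) (j := 0) (m' := F.m) (K' := J + (t + 1)) (j' := t + 1) (by omega)) B).tgt) ∧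
                ∀ ν, (B10Eq27TorusAxialLog.rel z ℓ'.src ν).natAbs ≤ 2
              then logVec (su2Quat (descendTo F ℰp (J + (t + 1)) K (by omega) (fun ℓ => expPoint (ζ ℓ) * U₀ ℓ : GaugeField (F.P K) 0 (Matrix.specialUnitaryGroup (Fin 2) ℂ)) ℓ' * (descendTo F ℰp (J + (t + 1)) K (by omega) U₀ ℓ')⁻¹)) else 0)‖ ^ 2
        else 0))) := by
  have hL2 : (2 : ℝ) ≤ (F.L : ℝ) := by exact_mod_cast F.hL.2
  obtain ⟨hO0, hOSC⟩ := oscProfiled_letters F U₀ X C_B α hCB hα hBKG h24 hSU hρ0 hρr ha0 ha hρα ε r c₀ hε0 hεnn hε hwin hc₀nn hc₀ hr0 hr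
    Cε Cr Cc mT hCε hCr hεp hrp hMT hcc
  -- the explicit level-free `o` is nonnegative (denominators `L² − 1`, `L − 1`, `L² − L` are positive)
  have hL1' : (1 : ℝ) ≤ ((F.P K).L : ℝ) := by show (1 : ℝ) ≤ (F.L : ℝ); exact one_le_two.trans hL2
  have h1 : (0 : ℝ) ≤ ((F.P K).L : ℝ) ^ 2 - 1 := sub_nonneg.2 (one_le_pow₀ hL1')
  have h2 : (0 : ℝ) ≤ ((F.P K).L : ℝ) - 1 := sub_nonneg.2 hL1'
  have h3 : (0 : ℝ) ≤ ((F.P K).L : ℝ) ^ 2 - ((F.P K).L : ℝ) := by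
    rw [sq]; exact sub_nonneg.2 (le_mul_of_one_le_left (zero_le_one.trans hL1') hL1')
  have ho : (0 : ℝ) ≤ (2 * ((((F.P K).d : ℕ) : ℝ) * ((3 * (F.P K).L : ℕ) : ℝ)) * (2 * Cε * mT + mT * (((1 + 4 * (((F.P K).d + 2 : ℕ) : ℝ)) * Real.exp ((((F.P K).d + 2 : ℕ) : ℝ) * (422 + 1616 * (((F.P K).d + 2 : ℕ) : ℝ)) * (((((((F.P K).d + 2) * (F.P K).L : ℕ) : ℝ) ^ 2 / 4) * ((C_B + 1) * α)) / (((F.P K).L : ℝ) ^ 2 - 1)))) / ((F.P K).L : ℝ)) * ((2 * 67 * ((((F.P K).d + 2) * (F.P K).L : ℕ) : ℝ) / a₀) * (2 * ((((F.P K).d - 1 : ℕ) : ℝ) * ((2 * (F.P K).L : ℕ) : ℝ)) * (2 * ((C_B + 1) * α)) / (((F.P K).L : ℝ) ^ 2 - 1) + (2 * Cε + (2 * ((C_B + 1) * α))) / (((F.P K).L : ℝ) - 1))) + Cc + 2 * (((1 + 4 * (((F.P K).d + 2 : ℕ) : ℝ)) * Real.exp ((((F.P K).d + 2 : ℕ)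 : ℝ) * (422 + 1616 * (((F.P K).d + 2 : ℕ) : ℝ)) * (((((((F.P K).d + 2) * (F.P K).L : ℕ) : ℝ) ^ 2 / 4) * ((C_B + 1) * α)) / (((F.P K).L : ℝ) ^ 2 - 1)))) * Cr / (((F.P K).L : ℝ) ^ 2 - ((F.P K).L : ℝ))))) := by
    refine mul_nonneg (mul_nonneg zero_le_two (by positivity)) (add_nonneg (add_nonneg (add_nonneg (by positivity) ?_) hCc) (mul_nonneg zero_le_two (div_nonneg (by positivity) h3)))
    exact mul_nonneg (mul_nonneg hmT (div_nonneg (by positivity) (by positivity))) (mul_nonneg (by positivity) (add_nonneg (div_nonneg (by positivity) h1) (div_nonneg (by positivity) h2)))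
  exact c1Budget_profiled F hJK Cst hCst U₀ ζ X hXdef Mg hMg hMg4 C_B α hCB hα hBKG h24 hSU hρ0 hρr ha0 ha Mb hMb0 hMb hMb16
    (fun n : ℕ => match n with
          | 0 => (0 : ℝ)
          | kk + 1 => (2 * ((((F.P K).d : ℕ) : ℝ) * ((3 * (F.P K).L : ℕ) : ℝ)) * (2 * Cε * mT + mT * (((1 + 4 * (((F.P K).d + 2 : ℕ) : ℝ)) * Real.exp ((((F.P K).d + 2 : ℕ) : ℝ) * (422 + 1616 * (((F.P K).d + 2 : ℕ) : ℝ)) * (((((((F.P K).d + 2) * (F.P K).L : ℕ) : ℝ) ^ 2 / 4) * ((C_B + 1) * α)) / (((F.P K).L : ℝ) ^ 2 - 1)))) / ((F.P K).L : ℝ)) * ((2 * 67 * ((((F.P K).d + 2) * (F.P K).L : ℕ) : ℝ) / a₀) * (2 * ((((F.P K).d - 1 : ℕ) : ℝ) * ((2 * (F.P K).L : ℕ) : ℝ)) * (2 * ((C_B + 1) * α)) / (((F.P K).L : ℝ) ^ 2 - 1) + (2 * Cε + (2 * ((C_B + 1) * α))) / (((F.P K).L : ℝ) - 1))) + Cc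 + 2 * (((1 + 4 * (((F.P K).d + 2 : ℕ) : ℝ)) * Real.exp ((((F.P K).d + 2 : ℕ) : ℝ) * (422 + 1616 * (((F.P K).d + 2 : ℕ) : ℝ)) * (((((((F.P K).d + 2) * (F.P K).L : ℕ) : ℝ) ^ 2 / 4) * ((C_B + 1) * α)) / (((F.P K).L : ℝ) ^ 2 - 1)))) * Cr / (((F.P K).L : ℝ) ^ 2 - ((F.P K).L : ℝ))))) * ((F.L : ℝ) ^ (2 * kk) / (F.L : ℝ) ^ (2 * (K - J))))
    hO0 hOSC hρα hρδ
    (2 * ((((F.P K).d : ℕ) : ℝ) * ((3 * (F.P K).L : ℕ) : ℝ)) * (2 * Cε * mT + mT * (((1 + 4 * (((F.P K).d + 2 : ℕ) : ℝ)) * Real.exp ((((F.P K).d + 2 : ℕ) : ℝ) * (422 + 1616 * (((F.P K).d + 2 : ℕ) : ℝ)) * (((((((F.P K).d + 2) * (F.P K).L : ℕ) : ℝ) ^ 2 / 4) * ((C_B + 1) * α)) / (((F.P K).L : ℝ) ^ 2 - 1)))) / ((F.P K).L : ℝ)) * ((2 * 67 * ((((F.P K).d + 2) * (F.P K).L : ℕ)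 : ℝ) / a₀) * (2 * ((((F.P K).d - 1 : ℕ) : ℝ) * ((2 * (F.P K).L : ℕ) : ℝ)) * (2 * ((C_B + 1) * α)) / (((F.P K).L : ℝ) ^ 2 - 1) + (2 * Cε + (2 * ((C_B + 1) * α))) / (((F.P K).L : ℝ) - 1))) + Cc + 2 * (((1 + 4 * (((F.P K).d + 2 : ℕ) : ℝ)) * Real.exp ((((F.P K).d + 2 : ℕ) : ℝ) * (422 + 1616 * (((F.P K).d + 2 : ℕ) : ℝ)) * (((((((F.P K).d + 2) * (F.P K).L : ℕ) : ℝ) ^ 2 / 4) * ((C_B + 1) * α)) / (((F.P K).L : ℝ) ^ 2 - 1)))) * Cr / (((F.P K).L : ℝ) ^ 2 - ((F.P K).L : ℝ)))))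
    m ho (fun _ _ => le_rfl) hMbsq hMbm c hc0 hc4 hζc Mbar hM0 hM1 hM

end Summit.QuantumFields.YangMills.Theorems.FluctuationComparisonRegPrIntLS2BetaCurlBudgetPhysical

end
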